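import Summits.BirchSwinnertonDyer.Rank1Residual.F1Sign2.TwoTorsionPlanesAtTwo
import Summits.BirchSwinnertonDyer.Rank1Residual.F1Sign2.TwistByTwoPointDivisibilityAtTwo
import HarnessLib

/-!
# Cell `bsd-f1-sign2` — kernel bookkeeping for IMC-WP53 (file 3 of 3 of the `Sketch53.v4` port: `F1Sign2/HalfPeriodWeilPairingAtTwo.lean`,
# `F1Sign2/TwoTorsionPlanesAtTwo.lean`)

THEOREMS ONLY (no `def`, no `sorry`, no named fact, no instance; ns `…Rank1Residual.F1Sign2` as files 1–2).  Contents: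
(1) -imc g17's proved bookkeeping from `HOME/MEMO-imc-data/dimc53/lean/Sketch53.v4.lean` d9205c894b9424ec l.454–497 VERBATIM — the pigeonhole
`exists_ne_map_eq_of_four_to_three` (P53f ⟹ P53m shape), `modTwoCongr_refl/symm/trans`, `HalfPeriodTransportLawAtTwo.plus_congr_of_least_of_least`,
`HalfPeriodTransportLawAtTwo.plus_congr_of_mapsLeast` (P53b ⟹ the symbol-level content of P53r);
(2) REF1 §181's sorry-free certificates from `HOME/REF1-data/b181/lean/Probe181.lean` 60a93f99d4b9065b (ns `REF1g16f` → `F1Sign2`) VERBATIM except where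
marked: `not_halfPeriodsPair_zero_left` (junk `u = 0` never pairs), `not_odd_quotient_of_zero` (S53 consistent at the junk value; REF1's helper
`two_mul_intCast_add_one_ne_zero` is INLINED here because that exact statement already exists in the tree under
`Literature.MathematicalPhysics.QuantumFieldTheory.ConformalBootstrap3D`), `modTwoCongr_intCast_iff`, `not_modTwoCongr_zero_one`, `not_modTwoCongr_half_zero`,
`realRoot_eq_of_isLeast_of_isGreatest` (Δ < 0 face), `carriesTwoTorsion_const_of_root` (the JUNK constant carrier behind the P53i/P53o kills),
`mapsLeastTwoTorsionRoot_refl`, `mapsLeast_of_increasing_of_onto` (L181: the P52r ⟸ P53r glue needs root-ONTO), `liesInTwoTorsionPlane_refl`,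
`atMostThree_conclusion_of_eq`, `sharpModTwoLeastRoot_mono` (P53r's trace-congruence hypothesis is droppable), `modTwoCongr_add_self_iff_zero`;
L181b (`Δ ≡ 5 (mod 8)` at supersingular 2): the identity `delta_eq_eight_mul_add_five` and the congruence ALREADY EXIST in the tree
(`F1Sign2/TwistByTwoPointDivisibilityAtTwo.lean`, J151: `delta_eq_eight_mul_add_five`, `delta_emod_eight_of_even_a1_odd_a3`, imported and REUSED, not
re-declared); filed here are REF1's `W`-form wrappers `delta_emod_eight_of_even_a₁_odd_a₃` (proof rerouted through the tree lemma) and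
`delta_emod_eight_ne_one_of_even_a₁_odd_a₃` (verbatim);
(3) from `Probe181c.lean` ee32b5222e9797f7 (ns `REF1g16h` → `F1Sign2`) VERBATIM: `evalReal_C`, `mapsConnected_refl`, `carriesTwoTorsion_X` (T181i/T181o, the
kernel forms of the kills, quantify over the KILLED v4 bodies, which are not filed, and are therefore not ported — their text is in file 2's header);
(4) typer support for REF1 duty (3): `not_carriesTwoTorsion_C_of_irreducible` — under the repair clause C′ (`Irreducible ψ_{W'}`) NO constant polynomial
carries the 2-torsion, so P53i′/P53o′ are immune to the T181i/T181o degeneration.  Typer -ty g16; std axioms checked on the combined scratch.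
BSD is not proved by this; no item closed.
-/

set_option autoImplicit false

noncomputable section

open scoped Classical MatrixGroups ModularForm

open CongruenceSubgroup WeierstrassCurve Literature.NumberTheory.EllipticCurves
  Literature.NumberTheory.EllipticCurves.ModularForms Literature.NumberTheory.EllipticCurves.Sprung2017

namespace Summit.BirchSwinnertonDyer.Rank1Residual.F1Sign2


/-! ## -imc g17 bookkeeping (Sketch53.v4 l.454–497, verbatim) -/

/-- Bookkeeping: P53f makes the plane a function of the connected point, whence at most three planes
(the content of P53m) — recorded here only as the trivial pigeonhole on `Fin 4 → Fin 3`. -/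
theorem exists_ne_map_eq_of_four_to_three (c : Fin 4 → Fin 3) : ∃ i j : Fin 4, i ≠ j ∧ c i = c j :=
  Fintype.exists_ne_map_eq_of_card_lt c (by simp)

/-- `ModTwoCongr` is reflexive. [folklore] -/
theorem modTwoCongr_refl (a : ℝ) : ModTwoCongr a a := ⟨0, by simp⟩

/-- `ModTwoCongr` is symmetric. [folklore] -/
theorem modTwoCongr_symm {a b : ℝ} (h : ModTwoCongr a b) : ModTwoCongr b a := by
  obtain ⟨k, hk⟩ := h
  exact ⟨-k, by push_cast; linarith⟩

/-- `ModTwoCongr` is transitive. [folklore] -/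
theorem modTwoCongr_trans {a b c : ℝ} (h₁ : ModTwoCongr a b) (h₂ : ModTwoCongr b c) :
    ModTwoCongr a c := by
  obtain ⟨k, hk⟩ := h₁
  obtain ⟨l, hl⟩ := h₂
  exact ⟨k + l, by push_cast; linarith⟩

/-- For `Δ < 0` (one real root, least and greatest at once) the transport law 53b makes ALL FOUR loop
symbols of a congruent pair congruent mod 2: here the plus/plus clause, extracted. [folklore] -/
theorem HalfPeriodTransportLawAtTwo.plus_congr_of_least_of_least (h : HalfPeriodTransportLawAtTwo)
    (W W' : WeierstrassCurve ℚ) [W.IsElliptic] [W'.IsElliptic] {N : ℕ} [NeZero N]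
    (f f' : CuspForm (Gamma0 N) 2) (hN : Odd N) (hf : IsNewformOf W f) (hf' : IsNewformOf W' f')
    (hW : Irreducible W.twoTorsionPolynomial.toPoly) (hW' : Irreducible W'.twoTorsionPolynomial.toPoly)
    (hsq : ¬ IsSquare W.Δ) (hK : ¬ TwoTorsionSplitAtTwo W)
    (g : Polynomial ℚ) (hg : CarriesTwoTorsion W W' g) (x : ℝ) (hx : IsLeastTwoTorsionRoot W x)
    (hgx : IsLeastTwoTorsionRoot W' (evalReal g x)) (r : ℚ) (hr : Nat.Coprime r.den N) :
    ModTwoCongr (twicePlusLoopSymbol f' r) (twicePlusLoopSymbol f r) :=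
  ((h W W' f f' hN hf hf' hW hW' hsq hK g hg x hx.1 r hr).1 hgx).1 hx

/-- 53b ⇒ the `MapsLeastTwoTorsionRootAtTwo` case of the plus-symbol congruence (the symbol-level
content of 53r): if `g(e₁) = e'₁` then `Φ⁺_{f'} ≡ Φ⁺_f` on every loop. [folklore] -/
theorem HalfPeriodTransportLawAtTwo.plus_congr_of_mapsLeast (h : HalfPeriodTransportLawAtTwo)
    (W W' : WeierstrassCurve ℚ) [W.IsElliptic] [W'.IsElliptic] {N : ℕ} [NeZero N]
    (f f' : CuspForm (Gamma0 N) 2) (hN : Odd N) (hf : IsNewformOf W f) (hf' : IsNewformOf W' f')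
    (hW : Irreducible W.twoTorsionPolynomial.toPoly) (hW' : Irreducible W'.twoTorsionPolynomial.toPoly)
    (hsq : ¬ IsSquare W.Δ) (hK : ¬ TwoTorsionSplitAtTwo W)
    (hmaps : MapsLeastTwoTorsionRootAtTwo W W') (x : ℝ) (hx : IsLeastTwoTorsionRoot W x)
    (r : ℚ) (hr : Nat.Coprime r.den N) :
    ModTwoCongr (twicePlusLoopSymbol f' r) (twicePlusLoopSymbol f r) := by
  obtain ⟨g, hg, hleast⟩ := hmaps
  exact h.plus_congr_of_least_of_least W W' f f' hN hf hf' hW hW' hsq hK g hg x hx (hleast x hx) r hr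

/-! ## REF1 §181 — CERTIFICATES (sorry-free; `REF1-data/b181/lean/Probe181.lean` l.452–573) -/

section Certificates181

/-- JUNK γ (A4): `cuspSymbol f γ = 0` for upper-triangular `γ` (`c = 0`); `0 ∈ 2Λ`, so `0` never pairs:
the right-hand sides of both `↔` clauses of S53 are `False` at `u = 0`. -/
theorem not_halfPeriodsPair_zero_left (Λ : AddSubgroup ℂ) (v : ℂ) : ¬ HalfPeriodsPairAtTwo Λ 0 v :=
  fun h => h.1 ⟨0, Λ.zero_mem, by simp⟩

/-- … and so are the left-hand sides: `2·re 0/Ω = 0` is never an odd integer (S53 is CONSISTENT at the junk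
value, not vacuous and not false there).  (REF1's two-step proof via `two_mul_intCast_add_one_ne_zero` inlined — typer.) -/
theorem not_odd_quotient_of_zero (Ω : ℝ) : ¬ ∃ k : ℤ, 2 * (0 : ℂ).re / Ω = 2 * (k : ℝ) + 1 := by
  rintro ⟨k, hk⟩
  have h0 : 2 * (0 : ℂ).re / Ω = 0 := by simp
  have h1 : ((2 * k + 1 : ℤ) : ℝ) = 0 := by push_cast; rw [← hk, h0]
  have h2 : (2 * k + 1 : ℤ) = 0 := by exact_mod_cast h1
  omega

/-- `ModTwoCongr` on integers is congruence mod 2 (so the loop-symbol clauses are genuine parity constraints). -/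
theorem modTwoCongr_intCast_iff (m n : ℤ) : ModTwoCongr (m : ℝ) (n : ℝ) ↔ (2 : ℤ) ∣ m - n := by
  constructor
  · rintro ⟨k, hk⟩
    refine ⟨k, ?_⟩
    have h : ((m - n : ℤ) : ℝ) = ((2 * k : ℤ) : ℝ) := by push_cast; linarith
    exact_mod_cast h
  · rintro ⟨k, hk⟩
    refine ⟨k, ?_⟩
    have h : ((m - n : ℤ) : ℝ) = ((2 * k : ℤ) : ℝ) := by rw [hk]
    push_cast at h
    linarith

/-- NON-TRIVIALITY: `0 ≢ 1 (mod 2)` in the sketch's real-number spelling. -/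
theorem not_modTwoCongr_zero_one : ¬ ModTwoCongr 0 1 := by
  intro h
  have h' : ModTwoCongr ((0 : ℤ) : ℝ) ((1 : ℤ) : ℝ) := by simpa using h
  rw [modTwoCongr_intCast_iff] at h'
  omega

/-- `ModTwoCongr` does record integrality of the difference: `½ ≢ 0`. -/
theorem not_modTwoCongr_half_zero : ¬ ModTwoCongr (1 / 2) 0 := by
  rintro ⟨k, hk⟩
  have h1 : (1 : ℝ) = 4 * (k : ℝ) := by linarith
  have h2 : ((1 : ℤ) : ℝ) = ((4 * k : ℤ) : ℝ) := by push_cast; linarith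
  have h3 : (1 : ℤ) = 4 * k := by exact_mod_cast h2
  omega

/-- DEGENERATE FACE `Δ < 0` (one real root): least = greatest, and then every real root IS that root — so the
two blocks of P53b collapse to «all four loop symbols congruent», consistent with P53a(i). -/
theorem realRoot_eq_of_isLeast_of_isGreatest (W : WeierstrassCurve ℚ) (x : ℝ)
    (h₁ : IsLeastTwoTorsionRoot W x) (h₂ : IsGreatestTwoTorsionRoot W x) :
    ∀ y ∈ realTwoTorsionRoots W, y = x :=
  fun y hy => le_antisymm (h₂.2 y hy) (h₁.2 y hy)

/-- JUNK `g` (A4): a CONSTANT `g = C c` carries the `2`-torsion iff `c` is a rational root of `ψ_{W'}`; excluded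
in P53b/P53c/P53m by `Irreducible ψ_{W'}` and on the basic locus by supersingularity at `2` (no `2`-torsion over
`ℚ₂`), but admitted by the bare relation (as for the g16 predicate, REF1 §178). -/
theorem carriesTwoTorsion_const_of_root (W W' : WeierstrassCurve ℚ) (c : ℚ)
    (hc : (W'.twoTorsionPolynomial.toPoly).eval c = 0) : CarriesTwoTorsion W W' (Polynomial.C c) := by
  refine ⟨by simp, ?_⟩
  rw [Polynomial.comp_C, hc, map_zero]
  exact dvd_zero _

/-- SANITY (A3): the identity polynomial carries `W` to itself and maps the least root to the least root. -/
theorem mapsLeastTwoTorsionRoot_refl (W : WeierstrassCurve ℚ) : MapsLeastTwoTorsionRootAtTwo W W := by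
  refine ⟨Polynomial.X, ⟨le_trans Polynomial.natDegree_X_le (by norm_num), by simp⟩, ?_⟩
  intro x hx
  simpa [evalReal] using hx

/-- GLUE GAP made explicit (L181): the g16 hypothesis «`g` increasing on the real roots» implies
`MapsLeastTwoTorsionRootAtTwo` only together with «`g` maps the real roots of `ψ_W` ONTO those of `ψ_{W'}`» —
true for irreducible cubics (a `G_ℚ`-map between transitive `3`-sets is a bijection) but NOT definitional; the
supersession P53r ⊒ P52r needs this root-bijection lemma in the port. -/
theorem mapsLeast_of_increasing_of_onto (W W' : WeierstrassCurve ℚ) (g : Polynomial ℚ)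
    (hg : CarriesTwoTorsion W W' g)
    (hinto : ∀ y ∈ realTwoTorsionRoots W, evalReal g y ∈ realTwoTorsionRoots W')
    (honto : ∀ y' ∈ realTwoTorsionRoots W', ∃ y ∈ realTwoTorsionRoots W, evalReal g y = y')
    (hinc : ∀ x y : ℝ, x ∈ realTwoTorsionRoots W → y ∈ realTwoTorsionRoots W → x < y →
      evalReal g x < evalReal g y) :
    MapsLeastTwoTorsionRootAtTwo W W' := by
  refine ⟨g, hg, fun x hx => ⟨hinto x hx.1, fun y' hy' => ?_⟩⟩
  obtain ⟨y, hy, rfl⟩ := honto y' hy'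
  rcases (hx.2 y hy).lt_or_eq with hlt | heq
  · exact le_of_lt (hinc x y hx.1 hy hlt)
  · rw [heq]

/-- `LiesInTwoTorsionPlaneAtTwo` is REFLEXIVE … -/
theorem liesInTwoTorsionPlane_refl {N : ℕ} (f : CuspForm (Gamma0 N) 2) : LiesInTwoTorsionPlaneAtTwo f f :=
  ⟨Or.inl fun _ _ => modTwoCongr_refl _, Or.inr (Or.inl fun _ _ => modTwoCongr_refl _)⟩

/-- … hence P53m's conclusion holds for free as soon as two of the four newforms COINCIDE (isogenous `W i`):
the pigeonhole has content only for four DISTINCT congruent newforms (12 Kilford classes `< 10⁴`). -/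
theorem atMostThree_conclusion_of_eq {N : ℕ} (f : Fin 4 → CuspForm (Gamma0 N) 2) (h : f 0 = f 1) :
    ∃ i j : Fin 4, i ≠ j ∧ LiesInTwoTorsionPlaneAtTwo (f i) (f j) :=
  ⟨0, 1, by decide, by rw [h]; exact liesInTwoTorsionPlane_refl _⟩

/-- HYPOTHESIS-REDUNDANCY probe for P53r: its explicit trace congruence `a_ℓ ≡ a'_ℓ (mod 2)` is implied (on
paper) by `MapsLeastTwoTorsionRootAtTwo` (⊇ `CarriesTwoTorsion` = `E[2] ≅ E'[2]`); formally the statement with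
the congruence hypothesis DROPPED implies the statement as typed (so a prover may ignore it). -/
theorem sharpModTwoLeastRoot_mono
    (h : ∀ (W W' : WeierstrassCurve ℚ) [W.IsElliptic] [W.IsGloballyMinimal] [W'.IsElliptic]
      [W'.IsGloballyMinimal],
      W.HasGoodReductionAtPrime 2 → W.frobeniusTrace 2 = 0 → UnitLValueAtTwo W → ¬ 2 ∣ W.tamagawaProduct →
      W'.HasGoodReductionAtPrime 2 → W'.frobeniusTrace 2 = 0 → UnitLValueAtTwo W' →
      ¬ 2 ∣ W'.tamagawaProduct → W.conductorNorm ℤ = W'.conductorNorm ℤ →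
      ¬ IsSquare W.Δ → MapsLeastTwoTorsionRootAtTwo W W' →
      ∀ {N : ℕ} [NeZero N] (f f' : CuspForm (Gamma0 N) 2), IsNewformOf W f → IsNewformOf W' f' →
        ∀ Ls Lf Ls' Lf' : IwasawaAlgebra 2, IsSprungPair f 2 0 Ls Lf → IsSprungPair f' 2 0 Ls' Lf' →
          ∀ i : ℕ, (2 : ℤ_[2]) ∣ PowerSeries.coeff i Ls - PowerSeries.coeff i Ls') :
    SharpModTwoLeastRootCongruenceAtTwo := by
  intro W W' _ _ _ _ h1 h2 h3 h4 h5 h6 h7 h8 h9 _ h11 h12 N _ f f' hf hf' Ls Lf Ls' Lf' hs hs' i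
  exact h W W' h1 h2 h3 h4 h5 h6 h7 h8 h9 h11 h12 f f' hf hf' Ls Lf Ls' Lf' hs hs' i

/-- P53c's two conjuncts, read at a `Δ < 0` reference curve where `Φ⁺_f ≡ Φ⁻_f` (P53a(i)): the third disjunct
`Φ_{f'} ≡ Φ⁺_f + Φ⁻_f` then says `Φ_{f'} ≡ 2Φ⁺_f ≡ 0` — i.e. it can only fire if the loop functional of `f'`
vanishes identically mod 2, which the Manin surjection `Γ₀(N)·0 ↠ Λ_{f'}` forbids; recorded as the algebraic
identity behind that remark. -/
theorem modTwoCongr_add_self_iff_zero (a b : ℝ) (hb : ∃ k : ℤ, b = k) :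
    ModTwoCongr a (b + b) ↔ ModTwoCongr a 0 := by
  obtain ⟨k, rfl⟩ := hb
  constructor
  · rintro ⟨l, hl⟩; exact ⟨l + k, by push_cast; linarith⟩
  · rintro ⟨l, hl⟩; exact ⟨l - k, by push_cast; linarith⟩

end Certificates181

/-! ## REF1 §181 — CERTIFICATE L181b: `Δ ≡ 5 (mod 8)` at supersingular `2` (`Probe181.lean` l.577–623; the algebraic identity and the
coordinate form are the tree's J151 lemmas `delta_eq_eight_mul_add_five` / `delta_emod_eight_of_even_a1_odd_a3` of
`F1Sign2/TwistByTwoPointDivisibilityAtTwo.lean`, reused) -/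

section Certificates181b

/-- L181b as a congruence on an arbitrary integral model: `a₁` even, `a₃` odd ⟹ `Δ % 8 = 5` — the shape of every `2`-integral
model with good SUPERSINGULAR reduction at `2` (`ã₁ = 0 ⟺ j̃ = 0 ⟺` supersingular in characteristic `2`; `Δ` odd then forces `a₃`
odd).  Consequences recorded in REF1 §181: odd `N` ∧ `a₂(E)` even ⟹ `Δ_min ≡ 5 (mod 8)` (Cremona: 141 284/141 284 curves, odd
`N < 3·10⁵`), hence `√Δ ∉ ℚ₂`, the image of `D₂` on `E[2]` is all of `S₃`, `Δ` is NOT a square (no `C₃`-image curve is supersingular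
at an odd-conductor `2`), and S53k sharpens to «`TwoTorsionSplitAtTwo W ⟺ Δ_min ≡ 1 (mod 8)`».  (REF1's statement verbatim; proof
rerouted through the tree's J151 lemma `delta_emod_eight_of_even_a1_odd_a3` — typer.) -/
theorem delta_emod_eight_of_even_a₁_odd_a₃ (W : WeierstrassCurve ℤ) (h₁ : Even W.a₁) (h₃ : Odd W.a₃) :
    W.Δ % 8 = 5 := by
  obtain ⟨s, hs⟩ := h₁
  obtain ⟨t, ht⟩ := h₃
  obtain ⟨a₁, a₂, a₃, a₄, a₆⟩ := W
  simp only at hs ht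
  subst hs
  subst ht
  rw [show s + s = 2 * s by ring]
  exact delta_emod_eight_of_even_a1_odd_a3 s a₂ t a₄ a₆

/-- … so such a `Δ` is never `≡ 1 (mod 8)`, i.e. never a `2`-adic square: the `a₂`-parity clause of S53k is implied
by the `Δ`-clause. -/
theorem delta_emod_eight_ne_one_of_even_a₁_odd_a₃ (W : WeierstrassCurve ℤ) (h₁ : Even W.a₁) (h₃ : Odd W.a₃) :
    W.Δ % 8 ≠ 1 := by
  rw [delta_emod_eight_of_even_a₁_odd_a₃ W h₁ h₃]
  norm_num

end Certificates181b

/-! ## REF1 §181 part C — CERTIFICATES (`Probe181c.lean` l.501–503, l.541–549, verbatim) -/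

section Certificates181c

/-- `evalReal (C c) x = c`. -/
theorem evalReal_C (c : ℚ) (x : ℝ) : evalReal (Polynomial.C c) x = (c : ℝ) := by
  simp [evalReal]

/-- P53f bookkeeping (R181f): `MapsConnectedTwoTorsionRootAtTwo W W g` holds for the identity carrier `g = X`. -/
theorem mapsConnected_refl (W : WeierstrassCurve ℚ) : MapsConnectedTwoTorsionRootAtTwo W W Polynomial.X := by
  intro x hx
  simpa using hx

/-- P53f sanity (A3): the identity carrier on `W = W'`, `f = f'` — both sides of the biconditional hold
(`liesInTwoTorsionPlane` is reflexive by `Or.inl rfl`-shaped clauses; here only the carrier side is certified). -/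
theorem carriesTwoTorsion_X (W : WeierstrassCurve ℚ) : CarriesTwoTorsion W W Polynomial.X :=
  ⟨le_trans Polynomial.natDegree_X_le (by norm_num), by simp⟩

end Certificates181c

/-! ## Typer support (REF1 §181 duty (3)): the repair clause C′ excludes the junk constant carrier -/

/-- With REF1's repair C′ in P53i′/P53o′ (`Irreducible W'.twoTorsionPolynomial.toPoly`, file 2) the junk CONSTANT carrier of
`carriesTwoTorsion_const_of_root` is EXCLUDED: `ψ_W` has degree `3`, so `ψ_W ∣ ψ_{W'} ∘ (C c) = C (ψ_{W'}(c))` forces `ψ_{W'}(c) = 0`,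
impossible for an irreducible cubic.  Hence T181i/T181o (REF1 `Probe181c.lean`) do not apply to the primed rows. -/
theorem not_carriesTwoTorsion_C_of_irreducible (W W' : WeierstrassCurve ℚ) (c : ℚ)
    (hirr : Irreducible W'.twoTorsionPolynomial.toPoly) : ¬ CarriesTwoTorsion W W' (Polynomial.C c) := by
  rintro ⟨-, hdvd⟩
  rw [Polynomial.comp_C] at hdvd
  have h3 : W.twoTorsionPolynomial.toPoly.natDegree = 3 :=
    Cubic.natDegree_of_a_ne_zero (by norm_num [WeierstrassCurve.twoTorsionPolynomial])
  have h3' : W'.twoTorsionPolynomial.toPoly.degree = 3 :=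
    Cubic.degree_of_a_ne_zero (by norm_num [WeierstrassCurve.twoTorsionPolynomial])
  by_cases hv : W'.twoTorsionPolynomial.toPoly.eval c = 0
  · have h1 := Polynomial.degree_eq_one_of_irreducible_of_root hirr hv
    rw [h3'] at h1
    exact absurd h1 (by decide)
  · have hu : IsUnit (Polynomial.C (W'.twoTorsionPolynomial.toPoly.eval c)) :=
      Polynomial.isUnit_C.mpr (Ne.isUnit hv)
    have h0 := Polynomial.natDegree_eq_zero_of_isUnit (isUnit_of_dvd_unit hdvd hu)
    omega

end Summit.BirchSwinnertonDyer.Rank1Residual.F1Sign2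

end
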